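/-
Copyright (c) 2026 the pub-hodgecm-mathlib formalisation cell (harness21).  Prover seat hodgecm-mathlib-LH10-p01 (g11), 2026-09-03.  Road M6 «ROW 2 ★ DYADIC TWIN» (LEAD
F0P3a-plan T14-66 ∕ T15-08); F3-5 pen LH7-p04 (g12) OFFER 02:00:29Z «SIG-F5 v2 §6.2 (1) hrow2 DICTIONARY» (F0P3a-p04 (g30) SIG-F5-draft v2, Table A row 21), taken 02:02Z.
-/
import Literature.NumberTheory.Rogawski1990.DepthZeroKappaTransferTypeTwoRowTwoWildOdd    -- ★ R2 (LH10-p01 (g10)) p852886: `ncard_rankStrata_two_sub_eq_neg_one_pow_mul_wildOdd` (ODD-order discriminant row)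
import Literature.NumberTheory.Rogawski1990.DepthZeroKappaTransferTypeTwoRowTwoWildUnit   -- ★ ROW-UNIT (F0P3a-p04 (g30)) p852933: `ncard_rankStrata_two_sub_eq_neg_one_pow_mul_wildUnit` (EVEN-order, unit-radicand row)
import Literature.NumberTheory.LocalFields.InertPlaceSkewDiscriminantRootWildUnit          -- ★ α2 (F0P3a-p04 (g30)) p852894: `exists_skew_sqrt_discriminant_wildUnit` (the W-unit frame `y d₀ wd k`)
import Literature.NumberTheory.LocalFields.DyadicQuadraticEvalOrder                        -- ★ (W2d) (LH4-p02 (g7)): `valued_le_valued_mul_self_sub_one_add` «AN ODD DEFECT IS RIGID»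
import Literature.NumberTheory.Rogawski1990.TypeTwoEisensteinData                         -- ★ F2 (F0P3a-p04 (g30)) p852809: `exists_v_eq_exp_neg_nat`, `exp_neg_one_pow` (and the Eisenstein letters' source `exists_eisensteinData`)
import HarnessLib

/-!
# The depth-zero κ-transfer, type (2): ROW 2 read on EISENSTEIN DATA — the `hrow2` dictionary at ANY residue characteristic

Topic `NumberTheory/Rogawski1990`; namespace `Literature.NumberTheory.Rogawski1990`.  THEOREMS ONLY (no definition, no instance, no notation, no named fact, no `sorry`); kernel lane
`--supports stmt-HodgeConjecture-24833`.  Cell `pub/hodgecm-mathlib` (D-0151), crux H413 = `stmt-HodgeConjecture-24833`; road M6 «ROW 2 ★ DYADIC TWIN» (LEAD F0P3a-plan (g16)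
T14-66), the F5 head plan SIG-F5-draft v2 (F0P3a-p04 (g30)) §6.2 (1) «`hrow2` DICTIONARY» (Table A row 21): the ★ tame G-side head
`DepthZeroKappaTransferTypeTwoGSide.finsum_finExplicitDelta_mul_classOrbitalIntegral_depthZero_eq_of_irreducible` carries the FREE ROW of the type-(2) socket as the binder
`hrow2` (:253–:268, «`n₂(δ₊) − n₂(δ₋) = (−1)^n (q+1) q^{N+n−1}`», `N` from the odd discriminant token `hN` at `|2| = 1`).  The dyadic F5 head replaces `hN` by the EISENSTEIN
BLOCK of ★ F2 `exists_eisensteinData` (`Θ = α•1 + β•g_w`, `|det Θ| = |ϖ|`, `|tr Θ| < 1`, `u_w•1 − g_w = a•1 + b•Θ`, `|b| = |ϖ|^{N′}` — `N′ = ord_w b`, the CONDUCTOR exponent).  THIS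
FILE delivers `hrow2` IN THAT CURRENCY, at an inert-unramified place of ANY residue characteristic (`|2|_v = exp(−e)` a parameter): **`n₂(δ₊) − n₂(δ₋) = (−1)^n (q+1) q^{N′+n−1}`**,
by `rcases` on the order of `disc χ_{g_w} = tr² − 4·det` — ODD: ★ R2 `…_wildOdd` (`ord disc = 2(N′+e) + 1`, exponent `(N′+e) − e + n − 1`); EVEN (and non-square, by `hirr`): ★ α2's
unit frame `(y, d₀ = 1 + wd, |wd| = exp(−(2k+1)) > |4|, |y| = exp(−M))` fed to ★ ROW-UNIT `…_wildUnit` (exponent `M + k − e + n − 1`) with the DEFECT IDENTITY `M = N′ + m`,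
`k + m = e` (`|tr Θ| = exp(−m)`) proved here from ★ (W2d) «an odd defect is rigid» used twice.  Both exponents collapse to `N′ + n − 1`: the `hrow2` TEXT of the tame head with
`N := N′`, no `|2| = 1`, no `e` in the statement's conclusion.
HONEST LABEL: HC_CM is proved only modulo the 7 printed citations (2 remaining named inputs: hLiu418 = stmt-HodgeConjecture-24832, h413 = stmt-HodgeConjecture-24833) until rung 0 closes;
unconditional local algebra over ★ rows, count-neutral (zero label movement until F5 ★ + a desk-priced rider).

THE MATHEMATICS.  (1) `u•1 − g = a•1 + b•(α•1 + β•g)` with `χ_g` rootless forces `bβ = −1` (else `g` is scalar), and `tr(α1+βg)² − 4det(α1+βg) = β²(tr² g − 4 det g)`; so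
`disc g = b²·disc Θ`, `|disc g| = |ϖ|^{2N′}·|disc Θ|`.  (2) `|4 det Θ| = exp(−(2e+1))` is NOT a square value while `|tr Θ|²` is one, so `|disc Θ| = max(|tr Θ|², |4det Θ|)`:
ODD ROW `|tr Θ|² < |4 det Θ|`: `ord disc g = 2(N′+e)+1`, ★ R2 at `N := N′ + e`.  UNIT ROW `|tr Θ|² > |4det Θ|`: `|tr Θ| = exp(−m)`, `1 ≤ m ≤ e`, `ord disc g = 2(N′+m)`, `disc g` not a
square (`hirr`, char 0), ★ α2 gives `disc g = y²·ι d₀`, `d₀ = 1 + wd`; with the UNIT `z := b·tr Θ∕y` and `c := 4b²det Θ∕y²` (`ord c = 2(e−m)+1`) one has `z² − ι d₀ = c`, and ★ (W2d)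
applied to `(ι wd, z)` and to `(−c∕z², z⁻¹)` gives `ord c ≤ 2k+1 ≤ ord c`, i.e. `k + m = e`; ★ ROW-UNIT at `N := N′ + m` has exponent `(N′+m) + k − e + n − 1 = N′ + n − 1`.
(3) The torus identities `det·σdet = 1`, `σ tr = tr·σ det` for ★ α2 come from `γ_H ∈ U(Φ₂)` (★ `transpose_map_fst_evalRingHom_mul` + ★ `det_mul_map_det_eq_one_of_unitary_antidiag` ∕
`map_trace_mul_det_eq_trace_of_unitary_antidiag`).  [cite: Rogawski1990, §4.9 Lemma 4.9.3 p. 56, Prop. 4.9.1 (b) p. 55] [cite: Omeara1963, §63A 63:2–63:5] [cite: Flicker1998UnitaryFL, Props. 16–17 pp. 95–97]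

* §1 (model-free algebra) `trace_sq_sub_four_mul_det_smul_one_add_smul`, `mul_eq_neg_one_of_smul_one_sub_eq_of_not_exists_isRoot`, `mul_self_ne_exp_neg_two_mul_add_one`,
  `valued_sub_eq_of_lt_left`, `valued_sub_eq_of_lt_right`, `exp_odd_eq_of_unit_sq_sub` (the defect identity `k + m = e` in pure `Valued K ℤᵐ⁰` currency).
* §2 (the CM row) **`ncard_rankStrata_two_sub_eq_neg_one_pow_mul_of_eisensteinData`** = the GSide `hrow2` text at `N := N′`.

## References
* [Rogawski1990] J. D. Rogawski, *Automorphic Representations of Unitary Groups in Three Variables* (1990): §4.9 Lemma 4.9.3 p. 56, Prop. 4.9.1 (b) p. 55.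
* [Flicker1998UnitaryFL] Y. Z. Flicker, *Elementary proof of the fundamental lemma for a unitary group*, Canad. J. Math. 50 (1998): Props. 16–17 pp. 95–97, Thm. 18 p. 97.
* [Omeara1963] O. T. O'Meara, *Introduction to Quadratic Forms*, Grundlehren 117 (1963): §63A 63:2–63:5 (the quadratic defect of a unit; odd defects are rigid).
* [SerreLocalFields1979] J.-P. Serre, *Local Fields*, GTM 67 (1979): Ch. XIV §4, Ch. XV §2.
-/

set_option autoImplicit false

noncomputable section

open NumberField IsDedekindDomain Matrix Polynomial Finset
open scoped MatrixGroups WithZero ValuativeRel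

namespace Literature.NumberTheory.Rogawski1990

open ValuativeRel WithZero
open Literature.NumberTheory.Automorphic Literature.NumberTheory.Automorphic.UnitaryGroup
open Literature.NumberTheory.GaloisRepresentations Literature.NumberTheory.NumberFields Literature.NumberTheory.LocalFields

/-! ## §1 Model-free algebra -/

section Algebra

/-- `tr(α•1 + β•g)² − 4·det(α•1 + β•g) = β²·(tr g² − 4 det g)` for a `2 × 2` matrix (`tr = 2α + β tr g`, `det = α² + αβ tr g + β² det g`). [cite: Rogawski1990, §4.9 Lemma 4.9.3 p. 56] -/
theorem trace_sq_sub_four_mul_det_smul_one_add_smul {R : Type*} [CommRing R] (g : Matrix (Fin 2) (Fin 2) R) (α β : R) :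
    (α • (1 : Matrix (Fin 2) (Fin 2) R) + β • g).trace ^ 2 - 4 * (α • (1 : Matrix (Fin 2) (Fin 2) R) + β • g).det = β ^ 2 * (g.trace ^ 2 - 4 * g.det) := by
  have h01 : (1 : Matrix (Fin 2) (Fin 2) R) 0 1 = 0 := Matrix.one_apply_ne (by decide)
  have h10 : (1 : Matrix (Fin 2) (Fin 2) R) 1 0 = 0 := Matrix.one_apply_ne (by decide)
  rw [Matrix.trace_fin_two, Matrix.det_fin_two, Matrix.trace_fin_two, Matrix.det_fin_two]
  simp only [Matrix.add_apply, Matrix.smul_apply, Matrix.one_apply_eq, h01, h10, smul_eq_mul, mul_one, mul_zero, zero_add]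
  ring

/-- **`b·β = −1`**: if `u•1 − g = a•1 + b•(α•1 + β•g)` and `χ_g` has NO root, then `bβ = −1` — otherwise `(1 + bβ)•g` is scalar, so `g` is scalar and `χ_g = (X − c)²` has the root `c`.
[cite: Rogawski1990, §4.9 Lemma 4.9.3 p. 56] -/
theorem mul_eq_neg_one_of_smul_one_sub_eq_of_not_exists_isRoot {F : Type*} [Field F] (g : Matrix (Fin 2) (Fin 2) F)
    (hirr : ¬ ∃ x : F, g.charpoly.IsRoot x) {Θ : Matrix (Fin 2) (Fin 2) F} {u α β a b : F}
    (hΘ : Θ = α • (1 : Matrix (Fin 2) (Fin 2) F) + β • g) (hrel : u • (1 : Matrix (Fin 2) (Fin 2) F) - g = a • 1 + b • Θ) : b * β = -1 := by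
  by_contra hne
  have hc : 1 + b * β ≠ 0 := fun h0 => hne (by linear_combination h0)
  have h01 : (1 : Matrix (Fin 2) (Fin 2) F) 0 1 = 0 := Matrix.one_apply_ne (by decide)
  have h10 : (1 : Matrix (Fin 2) (Fin 2) F) 1 0 = 0 := Matrix.one_apply_ne (by decide)
  have key : ∀ i j : Fin 2, (u • (1 : Matrix (Fin 2) (Fin 2) F) - g) i j = (a • (1 : Matrix (Fin 2) (Fin 2) F) + b • (α • (1 : Matrix (Fin 2) (Fin 2) F) + β • g)) i j :=
    fun i j => by rw [← hΘ, hrel]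
  have e00 := key 0 0
  have e01 := key 0 1
  have e10 := key 1 0
  have e11 := key 1 1
  simp only [Matrix.sub_apply, Matrix.add_apply, Matrix.smul_apply, Matrix.one_apply_eq, h01, h10, smul_eq_mul, mul_one, mul_zero, zero_add] at e00 e01 e10 e11
  have hg01 : g 0 1 = 0 := by
    have h : (1 + b * β) * g 0 1 = 0 := by linear_combination -e01
    rcases mul_eq_zero.1 h with h | h
    · exact absurd h hc
    · exact h
  have hg10 : g 1 0 = 0 := by
    have h : (1 + b * β) * g 1 0 = 0 := by linear_combination -e10
    rcases mul_eq_zero.1 h with h | h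
    · exact absurd h hc
    · exact h
  have hg11 : g 1 1 = g 0 0 := by
    have h : (1 + b * β) * (g 1 1 - g 0 0) = 0 := by linear_combination e00 - e11
    rcases mul_eq_zero.1 h with h | h
    · exact absurd h hc
    · exact sub_eq_zero.1 h
  refine hirr ⟨g 0 0, ?_⟩
  rw [Matrix.charpoly_fin_two, Polynomial.IsRoot.def]
  simp only [eval_add, eval_sub, eval_mul, eval_pow, eval_C, eval_X, Matrix.trace_fin_two, Matrix.det_fin_two, hg01, hg10, hg11]
  ring

/-- A square value is never `exp` of an odd exponent: `γ·γ ≠ exp(−(2k+1))` in `ℤᵐ⁰`. [cite: Omeara1963, §63A 63:2] -/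
theorem mul_self_ne_exp_neg_two_mul_add_one (γ : ℤᵐ⁰) (k : ℤ) : γ * γ ≠ exp (-(2 * k + 1)) := by
  intro h
  rcases eq_or_ne γ 0 with h0 | h0
  · rw [h0, zero_mul] at h
    exact WithZero.zero_ne_coe h
  · rw [← exp_log h0, ← exp_add, exp_inj] at h
    omega

section Val

variable {K : Type*} [Field K] [Valued K ℤᵐ⁰]

/-- `|x − y| = |x|` when `|y| < |x|`. [cite: Omeara1963, §11] -/
theorem valued_sub_eq_of_lt_left {x y : K} (h : Valued.v y < Valued.v x) : Valued.v (x - y) = Valued.v x := by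
  rw [sub_eq_add_neg, Valuation.map_add_eq_of_lt_left _ (by rwa [Valuation.map_neg])]

/-- `|x − y| = |y|` when `|x| < |y|`. [cite: Omeara1963, §11] -/
theorem valued_sub_eq_of_lt_right {x y : K} (h : Valued.v x < Valued.v y) : Valued.v (x - y) = Valued.v y := by
  rw [sub_eq_add_neg, Valuation.map_add_eq_of_lt_right _ (by rwa [Valuation.map_neg]), Valuation.map_neg]

/-- **THE DEFECT IDENTITY `k + m = e`** (pure valued-field form).  If `|2| = exp(−e)`, a UNIT `z` and elements `W`, `c` satisfy `z·z − (1 + W) = c` with `|W| = exp(−(2k+1))`,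
`|4| < |W|`, and `|c| = exp(−(2j+1))` with `|4| < |c|`, then `j = k` — ★ (W2d) «an odd defect is rigid» (`|W| ≤ |x² − (1+W)|` for all `x`) at `x := z` gives `|W| ≤ |c|`, and at
`(W′, x) := (−c∕z², z⁻¹)` (`1 + W′ = (1+W)∕z²`, `x² − (1+W′) = −W∕z²`) gives `|c| ≤ |W|`. [cite: Omeara1963, §63A 63:2–63:5] -/
theorem exp_odd_eq_of_unit_sq_sub {z W c : K} {k j : ℤ} (hz : Valued.v z = 1) (hzWc : z * z - (1 + W) = c)
    (hW : Valued.v W = exp (-(2 * k + 1))) (h4W : Valued.v (4 : K) < Valued.v W)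
    (hc : Valued.v c = exp (-(2 * j + 1))) (h4c : Valued.v (4 : K) < Valued.v c) : j = k := by
  have hz0 : z ≠ 0 := (Valuation.ne_zero_iff _).1 (by rw [hz]; exact one_ne_zero)
  -- `|W| ≤ |c|`
  have h1 : Valued.v W ≤ Valued.v c := by
    have h := valued_le_valued_mul_self_sub_one_add h4W (fun y => by rw [hW]; exact (mul_self_ne_exp_neg_two_mul_add_one _ k).symm) z
    rwa [hzWc] at h
  -- `|c| ≤ |W|` from the symmetric reading
  obtain ⟨W', hW'⟩ : ∃ W' : K, W' = -c * z⁻¹ * z⁻¹ := ⟨_, rfl⟩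
  have hzinv : z * z⁻¹ = 1 := mul_inv_cancel₀ hz0
  have hvW' : Valued.v W' = Valued.v c := by
    rw [hW', Valuation.map_mul, Valuation.map_mul, Valuation.map_neg, map_inv₀, hz, inv_one, mul_one, mul_one]
  have hx : z⁻¹ * z⁻¹ - (1 + W') = -W * z⁻¹ * z⁻¹ := by
    rw [hW']
    linear_combination (-(z⁻¹ * z⁻¹)) * hzWc + (z * z⁻¹ + 1) * hzinv
  have hvx : Valued.v (z⁻¹ * z⁻¹ - (1 + W')) = Valued.v W := by
    rw [hx, Valuation.map_mul, Valuation.map_mul, Valuation.map_neg, map_inv₀, hz, inv_one, mul_one, mul_one]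
  have h2 : Valued.v c ≤ Valued.v W := by
    have h := valued_le_valued_mul_self_sub_one_add (w := W') (by rw [hvW']; exact h4c)
      (fun y => by rw [hvW', hc]; exact (mul_self_ne_exp_neg_two_mul_add_one _ j).symm) z⁻¹
    rw [hvx, hvW'] at h
    exact h
  have h := le_antisymm h1 h2
  rw [hW, hc, exp_inj] at h
  omega

end Val

end Algebra

/-! ## §2 ROW 2 on Eisenstein data (the `hrow2` dictionary) -/

section CM

open Literature.NumberTheory.Automorphic.IntegralReduction

variable (L : Type) [Field L] [NumberField L] [IsCMField L] {v : HeightOneSpectrum (𝓞 ↥(maximalRealSubfield L))}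
variable (H' : Matrix (Fin 3) (Fin 3) L)

set_option synthInstance.maxHeartbeats 200000 in
set_option maxHeartbeats 800000 in  -- the ≈ 40-binder statement + TWO ★ row instantiations + the α2 frame (★ R2 ∕ ROW-UNIT need 400000 for ONE row each; wall ≈ 20 s)
open scoped Classical in
/-- **ROW 2 ON EISENSTEIN DATA — THE `hrow2` DICTIONARY.**  At an inert-UNRAMIFIED place `v` of ANY residue characteristic (`|2|_v = exp(−e)`), for a deep `G`-regular type-(2) `γ_H`
(`χ_{g_w}` rootless in `L_w`, `|χ_g(u)|_w = exp(−n)`, `1 ≤ n`) carrying the EISENSTEIN BLOCK of ★ F2 `exists_eisensteinData` — `Θ = α•1 + β•g_w`, `|det Θ| = |ϖ|`, `|tr Θ| < 1`,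
`u_w•1 − g_w = a•1 + b•Θ`, `|b| = |ϖ|^{N′}` (`|ϖ| = exp(−1)`) — and deep matches `δ₊`, `δ₋` with `κ = ±1`:
`n₂(δ₊) − n₂(δ₋) = (−1)^n · (q+1) · q^{N′+n−1}` — the FREE-ROW binder `hrow2` of ★ `DepthZeroKappaTransferTypeTwoGSide.finsum_finExplicitDelta_mul_classOrbitalIntegral_depthZero_eq_of_irreducible`
(:253–:268) TOKEN FOR TOKEN at `N := N′`, WITHOUT `|2| = 1`.  Proof: order of `tr² − 4det = b²·disc Θ` — odd ⇒ ★ R2 `…_wildOdd` at `N′ + e`; even ⇒ ★ α2 + the defect identity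
`k + m = e` (§1) + ★ ROW-UNIT `…_wildUnit` at `N′ + m`.  [cite: Rogawski1990, §4.9 Lemma 4.9.3 p. 56, Prop. 4.9.1 (b) p. 55] [cite: Flicker1998UnitaryFL, Props. 16–17 pp. 95–97]
[cite: Omeara1963, §63A 63:2–63:5] -/
theorem ncard_rankStrata_two_sub_eq_neg_one_pow_mul_of_eisensteinData
    (hH' : (H'.map (IsCMField.complexConj L))ᵀ = H') (w : PlacesOver L v)
    (hw : IsCMField.complexConj L • w.1 = w.1) (hv : Algebra.IsUnramifiedIn (𝓞 L) v.asIdeal)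
    (hH'w : IsUnit (placeForm H' w.1)) (hH'i : hH'w.unit ∈ glInt 3 (w.1.adicCompletion L))
    {e : ℕ} (he : Valued.v (2 : v.adicCompletion ↥(maximalRealSubfield L)) = WithZero.exp (-(e : ℤ)))
    {γH : (cmDatum L 2 (Matrix.of fun i j : Fin 2 => if i.val + j.val + 1 = 2 then (1 : L) else 0)).Local v ×
      (cmDatum L 1 (Matrix.of fun i j : Fin 1 => if i.val + j.val + 1 = 1 then (1 : L) else 0)).Local v}
    (hreg : IsLocalGRegular L v γH)
    (hirr : ¬ ∃ x : w.1.adicCompletion L, (((γH.1.val : GL (Fin 2) (LocalRing L v)).val.map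
        (Pi.evalRingHom (fun w' : PlacesOver L v => w'.1.adicCompletion L) w)).charpoly).IsRoot x)
    (n : ℕ)
    (hn : Valued.v (((finCharpolyTwo L v γH).eval (finGammaTwo L v γH)) w) = WithZero.exp (-(n : ℤ)))
    (hn1 : 1 ≤ n)
    -- the EISENSTEIN BLOCK (★ F2 `exists_eisensteinData`'s letters at `K := L_w`, `g := g_w`, `u := u_w`)
    {ϖ : w.1.adicCompletion L} (hϖ : Valued.v ϖ = WithZero.exp (-1 : ℤ))
    {Θ : Matrix (Fin 2) (Fin 2) (w.1.adicCompletion L)} {α β a b : w.1.adicCompletion L} {N' : ℕ}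
    (hΘ : Θ = α • (1 : Matrix (Fin 2) (Fin 2) (w.1.adicCompletion L)) +
      β • ((γH.1.val : GL (Fin 2) (LocalRing L v)).val.map (Pi.evalRingHom (fun w' : PlacesOver L v => w'.1.adicCompletion L) w)))
    (hΘd : Valued.v Θ.det = Valued.v ϖ) (hΘt : Valued.v Θ.trace < 1)
    (hrel : finGammaTwo L v γH w • (1 : Matrix (Fin 2) (Fin 2) (w.1.adicCompletion L)) -
        (γH.1.val : GL (Fin 2) (LocalRing L v)).val.map (Pi.evalRingHom (fun w' : PlacesOver L v => w'.1.adicCompletion L) w) =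
      a • (1 : Matrix (Fin 2) (Fin 2) (w.1.adicCompletion L)) + b • Θ)
    (hb : Valued.v b = Valued.v ϖ ^ N')
    -- the two matches (the `hrow2` antecedents VERBATIM)
    (δp : (cmDatum L 3 H').Local v) (hp : IsLocalNormPair L H' v γH δp) (hκp : finKappaAt L v H' γH δp = 1)
    (htp : ∀ m : ℕ, ValuativeRel.valuation (w.1.adicCompletion L)
      (((((δp.val : GL (Fin 3) (LocalRing L v)).val.map (Pi.evalRingHom (fun w' : UnitaryGroup.PlacesOver L v => w'.1.adicCompletion L) w))).charpoly -
        (Polynomial.X - 1) ^ 3).coeff m) < 1)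
    (δm : (cmDatum L 3 H').Local v) (hm : IsLocalNormPair L H' v γH δm) (hκm : finKappaAt L v H' γH δm = -1)
    (htm : ∀ m : ℕ, ValuativeRel.valuation (w.1.adicCompletion L)
      (((((δm.val : GL (Fin 3) (LocalRing L v)).val.map (Pi.evalRingHom (fun w' : UnitaryGroup.PlacesOver L v => w'.1.adicCompletion L) w))).charpoly -
        (Polynomial.X - 1) ^ 3).coeff m) < 1) :
    (({q : (cmDatum L 3 H').Local v ⧸ cmLocalIntegralLevel L 3 H' v |
            q ∈ MulAction.fixedBy ((cmDatum L 3 H').Local v ⧸ cmLocalIntegralLevel L 3 H' v) δp ∧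
              (redMat ((((q.out⁻¹ * δp * q.out : (cmDatum L 3 H').Local v)).val : GL (Fin 3) (LocalRing L v)).val.map
                (Pi.evalRingHom (fun w' : UnitaryGroup.PlacesOver L v => w'.1.adicCompletion L) w)) - 1).rank = 2}.ncard : ℕ) : ℚ) -
      (({q : (cmDatum L 3 H').Local v ⧸ cmLocalIntegralLevel L 3 H' v |
            q ∈ MulAction.fixedBy ((cmDatum L 3 H').Local v ⧸ cmLocalIntegralLevel L 3 H' v) δm ∧
              (redMat ((((q.out⁻¹ * δm * q.out : (cmDatum L 3 H').Local v)).val : GL (Fin 3) (LocalRing L v)).val.map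
                (Pi.evalRingHom (fun w' : UnitaryGroup.PlacesOver L v => w'.1.adicCompletion L) w)) - 1).rank = 2}.ncard : ℕ) : ℚ) =
      (-1 : ℚ) ^ n * ((Ideal.absNorm v.asIdeal : ℚ) + 1) * (Ideal.absNorm v.asIdeal : ℚ) ^ (N' + n - 1) := by
  -- ABBREVIATIONS: `σ = σ_w`, `g = g_w`, `t = tr g`, `D = det g`
  set σ : w.1.adicCompletion L →+* w.1.adicCompletion L := galAdicCompletionMap (L := L) (IsCMField.complexConj L) hw with hσdef
  set g : Matrix (Fin 2) (Fin 2) (w.1.adicCompletion L) :=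
    (γH.1.val : GL (Fin 2) (LocalRing L v)).val.map (Pi.evalRingHom (fun w' : PlacesOver L v => w'.1.adicCompletion L) w) with hgdef
  set t : w.1.adicCompletion L := g.trace with htdef
  set D : w.1.adicCompletion L := g.det with hDdef
  -- (0) valuations at `w`: `|ι a|_w = |a|_v`, `|2|_w = exp(−e)`, `|ϖ| ≠ 0`
  have he1 : v.asIdeal.ramificationIdx' w.1.asIdeal = 1 := ramificationIdx'_eq_one_of_isUnramifiedIn L v w hv
  have hιv : ∀ x : v.adicCompletion ↥(maximalRealSubfield L), Valued.v (toPlace v w x) = Valued.v x :=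
    valued_toPlace_of_ramificationIdx'_eq_one L v w he1
  have he' : Valued.v (2 : w.1.adicCompletion L) = exp (-(e : ℤ)) := by rw [← map_ofNat (toPlace v w) 2, hιv, he]
  have h4' : Valued.v (4 : w.1.adicCompletion L) = exp (-(2 * (e : ℤ))) := by
    rw [show (4 : w.1.adicCompletion L) = 2 * 2 by norm_num, Valuation.map_mul, he', ← exp_add]; congr 1; ring
  have h20 : (2 : w.1.adicCompletion L) ≠ 0 := (Valuation.ne_zero_iff _).1 (by rw [he']; exact exp_ne_zero)
  have hvϖ0 : Valued.v ϖ ≠ 0 := by rw [hϖ]; exact exp_ne_zero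
  -- (1) `bβ = −1`, `disc g = b²·disc Θ`
  have hbβ : b * β = -1 := mul_eq_neg_one_of_smul_one_sub_eq_of_not_exists_isRoot g hirr hΘ hrel
  have hb0 : b ≠ 0 := fun h0 => by rw [h0, zero_mul] at hbβ; exact zero_ne_one (by linear_combination -hbβ)
  have hdiscΘ : Θ.trace ^ 2 - 4 * Θ.det = β ^ 2 * (t ^ 2 - 4 * D) := by
    rw [hΘ]; exact trace_sq_sub_four_mul_det_smul_one_add_smul g α β
  have hdisc : t ^ 2 - 4 * D = b ^ 2 * (Θ.trace ^ 2 - 4 * Θ.det) := by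
    rw [hdiscΘ]
    have hb2 : b ^ 2 * β ^ 2 = 1 := by rw [← mul_pow, hbβ]; norm_num
    linear_combination (-(t ^ 2 - 4 * D)) * hb2
  have hvb : Valued.v b = exp (-(N' : ℤ)) := by rw [hb, hϖ, exp_neg_one_pow]
  -- (2) `|4 det Θ| = exp(−(2e+1))` (odd) vs. `|tr Θ²| = |tr Θ|²` (a square value)
  have h4det : Valued.v (4 * Θ.det) = exp (-(2 * (e : ℤ) + 1)) := by
    rw [Valuation.map_mul, h4', hΘd, hϖ, ← exp_add]; congr 1; ring
  have htr2 : Valued.v (Θ.trace ^ 2) = Valued.v Θ.trace * Valued.v Θ.trace := by rw [Valuation.map_pow, pow_two]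
  have hne : Valued.v (Θ.trace ^ 2) ≠ Valued.v (4 * Θ.det) := by
    rw [htr2, h4det]; exact mul_self_ne_exp_neg_two_mul_add_one _ _
  rcases hne.lt_or_gt with hlt | hgt
  · -- ===== ODD ROW: `|disc Θ| = exp(−(2e+1))`, `ord disc g = 2(N′+e)+1`
    have hdΘ : Valued.v (Θ.trace ^ 2 - 4 * Θ.det) = exp (-(2 * (e : ℤ) + 1)) := by rw [valued_sub_eq_of_lt_right hlt, h4det]
    have hN : Valued.v (t ^ 2 - 4 * D) = WithZero.exp (-((2 * (N' + e) + 1 : ℕ) : ℤ)) := by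
      rw [hdisc, Valuation.map_mul, Valuation.map_pow, hvb, hdΘ, ← WithZero.exp_nsmul, ← exp_add]
      congr 1; push_cast; ring
    have key := ncard_rankStrata_two_sub_eq_neg_one_pow_mul_wildOdd L H' hH' w hw hv hH'w hH'i he hreg hirr n (N' + e) hn hN (by omega)
      δp hp hκp htp δm hm hκm htm
    rw [show N' + e - e + n - 1 = N' + n - 1 by omega] at key
    exact key
  · -- ===== UNIT ROW: `|disc Θ| = |tr Θ|² = exp(−2m)`, `1 ≤ m ≤ e`, `ord disc g = 2(N′+m)`
    have htr0 : Θ.trace ≠ 0 := by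
      intro h0
      rw [h0, zero_pow two_ne_zero, Valuation.map_zero] at hgt
      exact (not_lt.2 zero_le) hgt
    obtain ⟨m, hmv⟩ := exists_v_eq_exp_neg_nat htr0 hΘt.le
    have hm1 : 1 ≤ m := by
      have h := hΘt; rw [hmv, ← exp_zero, exp_lt_exp] at h; omega
    have hme : m ≤ e := by
      have h := hgt; rw [htr2, hmv, h4det, ← exp_add, exp_lt_exp] at h; omega
    have hdΘ : Valued.v (Θ.trace ^ 2 - 4 * Θ.det) = exp (-(2 * (m : ℤ))) := by
      rw [valued_sub_eq_of_lt_left hgt, htr2, hmv, ← exp_add]; congr 1; ring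
    have hM : Valued.v (t ^ 2 - 4 * D) = WithZero.exp (-(2 * ((N' + m : ℕ) : ℤ))) := by
      rw [hdisc, Valuation.map_mul, Valuation.map_pow, hvb, hdΘ, ← WithZero.exp_nsmul, ← exp_add]
      congr 1; push_cast; ring
    -- `disc g` is not a square (else `(t + s)∕2` is a root of `χ_g`)
    have hns : ¬ IsSquare (t ^ 2 - 4 * D) := by
      rintro ⟨s, hs⟩
      refine hirr ⟨(t + s) / 2, ?_⟩
      rw [Matrix.charpoly_fin_two, Polynomial.IsRoot.def]
      simp only [eval_add, eval_sub, eval_mul, eval_pow, eval_C, eval_X]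
      rw [← htdef, ← hDdef]
      have hx : ((t + s) / 2) ^ 2 - t * ((t + s) / 2) + D = (s * s - (t ^ 2 - 4 * D)) / 4 := by
        field_simp
        ring
      rw [hx, ← hs, sub_self, zero_div]
    -- torus identities for ★ α2
    have hgunit : (g.map σ)ᵀ * (!![0, 1; 1, 0] : Matrix (Fin 2) (Fin 2) (w.1.adicCompletion L)) * g = !![0, 1; 1, 0] := by
      have h := transpose_map_fst_evalRingHom_mul L v w hw γH
      rw [UnitaryGroup.placeForm_antidiagTwo_eq_antidiag L v w] at h
      exact h
    have hσD : D * σ D = 1 := det_mul_map_det_eq_one_of_unitary_antidiag σ g hgunit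
    have hσt : σ t = t * σ D := by
      have h := map_trace_mul_det_eq_trace_of_unitary_antidiag σ g hgunit
      calc σ t = σ t * (D * σ D) := by rw [hσD, mul_one]
        _ = σ t * D * σ D := by ring
        _ = t * σ D := by rw [h]
    obtain ⟨y, d₀, wd, k, hy0, hD4, hσy, hdw, hwd, h4w, hNy⟩ :=
      Literature.NumberTheory.LocalFields.exists_skew_sqrt_discriminant_wildUnit L v w hw hv hσD hσt hM hns
    -- (3) THE DEFECT IDENTITY `k + m = e`: `z := b·trΘ∕y` is a unit, `c := 4b²detΘ∕y²` has `|c| = exp(−(2(e−m)+1))`, `z² − ι d₀ = c`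
    have hvy0 : Valued.v y ≠ 0 := (Valuation.ne_zero_iff _).2 hy0
    set W : w.1.adicCompletion L := toPlace v w wd with hWdef
    set z : w.1.adicCompletion L := b * Θ.trace * y⁻¹ with hzdef
    set c : w.1.adicCompletion L := 4 * b ^ 2 * Θ.det * y⁻¹ * y⁻¹ with hcdef
    have hvW : Valued.v W = exp (-(2 * (k : ℤ) + 1)) := by rw [hWdef, hιv, hwd]
    have h4W : Valued.v (4 : w.1.adicCompletion L) < Valued.v W := by
      rw [hWdef, hιv, ← map_ofNat (toPlace v w) 4, hιv]; exact h4w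
    have hvz : Valued.v z = 1 := by
      rw [hzdef, Valuation.map_mul, Valuation.map_mul, map_inv₀, hvb, hmv, hNy, ← exp_add, ← WithZero.exp_neg, ← exp_add, ← exp_zero]
      congr 1; push_cast; ring
    have hvc : Valued.v c = exp (-(2 * ((e : ℤ) - m) + 1)) := by
      rw [hcdef, Valuation.map_mul, Valuation.map_mul, Valuation.map_mul, Valuation.map_mul, Valuation.map_pow, map_inv₀, h4', hvb, hΘd, hϖ, hNy,
        ← WithZero.exp_nsmul, ← WithZero.exp_neg, ← exp_add, ← exp_add, ← exp_add, ← exp_add]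
      congr 1; push_cast; ring
    have h4c : Valued.v (4 : w.1.adicCompletion L) < Valued.v c := by
      rw [h4', hvc, exp_lt_exp]; omega
    have hzWc : z * z - (1 + W) = c := by
      -- `1 + W = ι d₀ = (t·t − 4D)∕y² = b²·disc Θ∕y²`
      have hιd₀ : toPlace v w d₀ = 1 + W := by rw [hdw, map_add, map_one]
      have hy2 : y * y ≠ 0 := mul_ne_zero hy0 hy0
      have hkey : (1 + W) * (y * y) = b ^ 2 * (Θ.trace ^ 2 - 4 * Θ.det) := by
        rw [← hιd₀, ← hdisc]; linear_combination hD4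
      have hyinv : y * y⁻¹ = 1 := mul_inv_cancel₀ hy0
      rw [hzdef, hcdef]
      linear_combination (-(y⁻¹ * y⁻¹)) * hkey + (1 + W) * (y * y⁻¹ + 1) * hyinv
    have hkm : ((e : ℤ) - m) = k := exp_odd_eq_of_unit_sq_sub hvz hzWc hvW h4W hvc h4c
    -- (4) ★ ROW-UNIT at `N := N′ + m`
    have hvϖF : Valued.v (HeckeCharacter.uniformizer ↥(maximalRealSubfield L) v : v.adicCompletion ↥(maximalRealSubfield L)) = WithZero.exp (-1 : ℤ) := by
      rw [← hιv]; exact valued_toPlace_uniformizer L v w hv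
    have key := ncard_rankStrata_two_sub_eq_neg_one_pow_mul_wildUnit L H' hH' w hw hv hH'w hH'i he hreg hirr n (N' + m) hn hdw hwd h4w hvϖF hD4 hσy hNy
      (by omega) δp hp hκp htp δm hm hκm htm
    rw [show N' + m + k - e + n - 1 = N' + n - 1 by omega] at key
    exact key

end CM

end Literature.NumberTheory.Rogawski1990

end
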